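import Mathlib
import HarnessLib
import Summits.CriticalPhenomena.CardyFormulaZ2.Theses.CardyComplexCone
import Summits.CriticalPhenomena.CardyFormulaZ2.Theorems.CardyComplexConeEdgeCoherenceDefs
import Literature.Probability.LatticeModels.ExplorationWinding

/-!
# Stub `stub_aliasing` of line `Sketch` (composition `FixedRadiusCut`) for crux `CardyComplexCone.EdgeCoherence`

Route `CardyComplexCone` (sub-problem `CriticalPhenomena/CardyFormulaZ2`), crux
`Summit.CriticalPhenomena.CardyFormulaZ2.Theses.CardyComplexCone.EdgeCoherence` (item stmt-CriticalPhenomena-11385).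
Helper file `--supports stmt-CriticalPhenomena-11385`: it proves, by name, the registered stub
`stub_aliasing : Sig.stub_aliasing`, i.e. **ALIASING** `HarmonicVanishing → EdgeCoherence`
(first lemma of the idea card `spin-aliasing-vertex-mode`), over the shared vocabulary of the definitions
module `Theorems/CardyComplexConeEdgeCoherenceDefs.lean` (`cornerObs`, `harmonic`, `HarmonicVanishing`, the
`Iff.rfl` bridge `edgeCoherence_iff_cornerObs`).

## Content and proof

`EdgeCoherence` asks for a universal class vector `u`, non-zero on a corner class, such that
`‖u (f'−v)·E_δ(v,f) − u (f−v)·E_δ(v,f')‖ ≤ ε δ^{1/3}` eventually as `δ → 0⁺`, locally uniformly; here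
`E_δ(v,f) = cornerObs (Λ δ) δ v f` definitionally. We take the witness `u ≡ 1` (non-zero on the class `0`,
`isCorner_self 0`). Every face cornered at `v` is `faceAt v c` for some `c : Fin 4`
(`exists_faceAt_of_isCorner`), so it suffices to bound class differences `E_a − E_b`,
`E_c := cornerObs (Λ δ) δ v (faceAt v c)`, by the three alias harmonics
`H_k := harmonic Λ δ k v = Σ_c i^{kc} E_c`, `k = 1, 2, 3`. This is exact finite Fourier inversion on `ℤ₄`:
`4 E_c = H₀ + i^{-c} H₁ + i^{-2c} H₂ + i^{-3c} H₃` with unit coefficients (`four_mul_eq_harmonics`, the four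
cases `c = 0, 1, 2, 3` by `ring` / `linear_combination` over `i² = −1`), hence
`4 (E_a − E_b) = (α−α') H₁ + (β−β') H₂ + (γ−γ') H₃` with `‖α−α'‖, ‖β−β'‖, ‖γ−γ'‖ ≤ 2`, i.e.
`‖E_a − E_b‖ ≤ ½ (‖H₁‖ + ‖H₂‖ + ‖H₃‖)` (`norm_sub_le_harmonics`). Feeding `HarmonicVanishing` with `ε/2`
gives `‖E_a − E_b‖ ≤ (3/4) ε δ^{1/3} ≤ ε δ^{1/3}` eventually (`δ > 0` from `self_mem_nhdsWithin`, so
`δ^{1/3} ≥ 0` by `Real.rpow_nonneg`).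

Sources: H. Duminil-Copin, S. Smirnov, *Conformal invariance of lattice models*, Clay Math. Proc. 15 (2012)
§8 (the `q = 1`, spin-`1/3` observable, Conj. 8.7); idea card
`Cruxes/EdgeCoherence/Ideas/spin-aliasing-vertex-mode.md` (§ "first lemma"); the model identity (5) of
`Cruxes/EdgeCoherence/TriageIdentitiesR1K1.lean`. All algebra is elementary and proved inline.
-/

noncomputable section

namespace Summit.CriticalPhenomena.CardyFormulaZ2.Cruxes.EdgeCoherence.FixedRadiusCut

open scoped BigOperators Topology
open Filter Set MeasureTheory
open Literature.Probability.LatticeModels Literature.Probability.RandomPlanarGeometry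
open Literature.Probability.Percolation (BondConfig bondPercolation half)
open Summit.CriticalPhenomena.CardyFormulaZ2.Theses.CardyComplexCone (EdgeCoherence)

/-! ### Finite Fourier inversion on `ℤ₄` (pure algebra over `ℂ`) -/

/-- The first harmonic written out: `H₁ = E₀ + i E₁ − E₂ − i E₃`. -/
private theorem harmonic_one_expand (E : Fin 4 → ℂ) :
    ∑ c : Fin 4, Complex.I ^ (1 * (c : ℕ)) * E c =
      E 0 + Complex.I * E 1 - E 2 - Complex.I * E 3 := by
  simp only [Fin.sum_univ_four, Fin.val_zero, Fin.val_one, Fin.val_two,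
    show ((3 : Fin 4) : ℕ) = 3 from rfl, pow_zero, one_mul, pow_one, Complex.I_sq,
    Complex.I_pow_three]
  ring

/-- The second harmonic written out: `H₂ = E₀ − E₁ + E₂ − E₃`. -/
private theorem harmonic_two_expand (E : Fin 4 → ℂ) :
    ∑ c : Fin 4, Complex.I ^ (2 * (c : ℕ)) * E c = E 0 - E 1 + E 2 - E 3 := by
  simp only [Fin.sum_univ_four, Fin.val_zero, Fin.val_one, Fin.val_two,
    show ((3 : Fin 4) : ℕ) = 3 from rfl, pow_mul, Complex.I_sq]
  ring

/-- The third harmonic written out: `H₃ = E₀ − i E₁ − E₂ + i E₃`. -/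
private theorem harmonic_three_expand (E : Fin 4 → ℂ) :
    ∑ c : Fin 4, Complex.I ^ (3 * (c : ℕ)) * E c =
      E 0 - Complex.I * E 1 - E 2 + Complex.I * E 3 := by
  have h6 : Complex.I ^ 6 = -1 := by rw [Complex.I_pow_eq_pow_mod]; norm_num [Complex.I_sq]
  have h9 : Complex.I ^ 9 = Complex.I := by rw [Complex.I_pow_eq_pow_mod]; norm_num
  simp only [Fin.sum_univ_four, Fin.val_zero, Fin.val_one, Fin.val_two,
    show ((3 : Fin 4) : ℕ) = 3 from rfl, Nat.reduceMul, pow_zero, Complex.I_pow_three, h6, h9]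
  ring

/-- **Finite Fourier inversion on `ℤ₄`.** For every class `c`, `4 E_c − H₀` is a combination of the
written-out aliases `H₁, H₂, H₃` with UNIT coefficients (`i^{-c}, i^{-2c}, i^{-3c}`). -/
private theorem four_mul_eq_harmonics (E : Fin 4 → ℂ) (c : Fin 4) :
    ∃ α β γ : ℂ, ‖α‖ = 1 ∧ ‖β‖ = 1 ∧ ‖γ‖ = 1 ∧
      4 * E c = (E 0 + E 1 + E 2 + E 3) + α * (E 0 + Complex.I * E 1 - E 2 - Complex.I * E 3) +
        β * (E 0 - E 1 + E 2 - E 3) + γ * (E 0 - Complex.I * E 1 - E 2 + Complex.I * E 3) := by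
  have hI : Complex.I * Complex.I = -1 := by rw [← sq, Complex.I_sq]
  fin_cases c
  · exact ⟨1, 1, 1, by simp, by simp, by simp, by simp; ring⟩
  · exact ⟨-Complex.I, -1, Complex.I, by simp, by simp, by simp,
      by simp; linear_combination (2 * (E 1 - E 3)) * hI⟩
  · exact ⟨-1, 1, -1, by simp, by simp, by simp, by simp; ring⟩
  · exact ⟨Complex.I, -1, -Complex.I, by simp, by simp, by simp,
      by simp; linear_combination (2 * (E 3 - E 1)) * hI⟩

/-- **Norm form of the inversion.** Class differences are controlled by the three aliases:
`‖E_a − E_b‖ ≤ ½ (‖H₁‖ + ‖H₂‖ + ‖H₃‖)`, `H_k = Σ_c i^{kc} E_c`. -/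
private theorem norm_sub_le_harmonics (E : Fin 4 → ℂ) (a b : Fin 4) :
    ‖E a - E b‖ ≤ (‖∑ c : Fin 4, Complex.I ^ (1 * (c : ℕ)) * E c‖ +
      ‖∑ c : Fin 4, Complex.I ^ (2 * (c : ℕ)) * E c‖ +
        ‖∑ c : Fin 4, Complex.I ^ (3 * (c : ℕ)) * E c‖) / 2 := by
  rw [harmonic_one_expand, harmonic_two_expand, harmonic_three_expand]
  obtain ⟨α, β, γ, hα, hβ, hγ, ha⟩ := four_mul_eq_harmonics E a
  obtain ⟨α', β', γ', hα', hβ', hγ', hb⟩ := four_mul_eq_harmonics E b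
  set H1 := E 0 + Complex.I * E 1 - E 2 - Complex.I * E 3
  set H2 := E 0 - E 1 + E 2 - E 3
  set H3 := E 0 - Complex.I * E 1 - E 2 + Complex.I * E 3
  have hab : (4 : ℂ) * (E a - E b) = (α - α') * H1 + (β - β') * H2 + (γ - γ') * H3 := by
    linear_combination ha - hb
  have h1 : ‖α - α'‖ ≤ 2 := (norm_sub_le _ _).trans (by rw [hα, hα']; norm_num)
  have h2 : ‖β - β'‖ ≤ 2 := (norm_sub_le _ _).trans (by rw [hβ, hβ']; norm_num)
  have h3 : ‖γ - γ'‖ ≤ 2 := (norm_sub_le _ _).trans (by rw [hγ, hγ']; norm_num)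
  have h4 : ‖(4 : ℂ) * (E a - E b)‖ = 4 * ‖E a - E b‖ := by
    rw [norm_mul]; norm_num
  have key : 4 * ‖E a - E b‖ ≤ 2 * ‖H1‖ + 2 * ‖H2‖ + 2 * ‖H3‖ := by
    rw [← h4, hab]
    calc ‖(α - α') * H1 + (β - β') * H2 + (γ - γ') * H3‖
        ≤ ‖(α - α') * H1‖ + ‖(β - β') * H2‖ + ‖(γ - γ') * H3‖ := norm_add₃_le
      _ = ‖α - α'‖ * ‖H1‖ + ‖β - β'‖ * ‖H2‖ + ‖γ - γ'‖ * ‖H3‖ := by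
          simp only [norm_mul]
      _ ≤ 2 * ‖H1‖ + 2 * ‖H2‖ + 2 * ‖H3‖ := by
          gcongr
  linarith [norm_nonneg H1, norm_nonneg H2, norm_nonneg H3]

/-- The inversion bound read over the vocabulary: the class differences of the corner observable at a
vertex are at most half the sum of the norms of its three alias harmonics. -/
private theorem norm_cornerObs_sub_le (Λ : ℝ → DiscreteDobrushin) (δ : ℝ) (v : Site 2) (a b : Fin 4) :
    ‖cornerObs (Λ δ) δ v (faceAt v a) - cornerObs (Λ δ) δ v (faceAt v b)‖ ≤
      (‖harmonic Λ δ 1 v‖ + ‖harmonic Λ δ 2 v‖ + ‖harmonic Λ δ 3 v‖) / 2 :=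
  norm_sub_le_harmonics (fun c => cornerObs (Λ δ) δ v (faceAt v c)) a b

/-! ### The stub -/

/-- Registered stub **ALIASING**: `HarmonicVanishing → EdgeCoherence`, with the universal class vector
`u ≡ 1` (finite Fourier inversion on `ℤ₄`, applied to `HarmonicVanishing` at `ε / 2`). -/
theorem stub_aliasing : Sig.stub_aliasing := by
  intro hH
  refine edgeCoherence_iff_cornerObs.2 ⟨fun _ => 1, ⟨0, isCorner_self 0, one_ne_zero⟩, ?_⟩
  intro D Λ hΩ hδ hadm K hK hKD ε hε
  filter_upwards [hH D Λ hΩ hδ hadm K hK hKD (ε / 2) (half_pos hε), self_mem_nhdsWithin]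
    with δ hδε hpos v f f' hf hf' hv
  obtain ⟨a, rfl⟩ := exists_faceAt_of_isCorner hf
  obtain ⟨b, rfl⟩ := exists_faceAt_of_isCorner hf'
  have h1 : ‖harmonic Λ δ 1 v‖ ≤ ε / 2 * δ ^ ((1:ℝ) / 3) := hδε v hv 1 (by simp)
  have h2 : ‖harmonic Λ δ 2 v‖ ≤ ε / 2 * δ ^ ((1:ℝ) / 3) := hδε v hv 2 (by simp)
  have h3 : ‖harmonic Λ δ 3 v‖ ≤ ε / 2 * δ ^ ((1:ℝ) / 3) := hδε v hv 3 (by simp)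
  have hδ0 : (0:ℝ) ≤ δ ^ ((1:ℝ) / 3) := Real.rpow_nonneg (le_of_lt (Set.mem_Ioi.1 hpos)) _
  have hεδ : (0:ℝ) ≤ ε * δ ^ ((1:ℝ) / 3) := mul_nonneg hε.le hδ0
  show ‖(1:ℂ) * cornerObs (Λ δ) δ v (faceAt v a) - 1 * cornerObs (Λ δ) δ v (faceAt v b)‖ ≤
    ε * δ ^ ((1:ℝ) / 3)
  rw [one_mul, one_mul]
  calc ‖cornerObs (Λ δ) δ v (faceAt v a) - cornerObs (Λ δ) δ v (faceAt v b)‖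
      ≤ (‖harmonic Λ δ 1 v‖ + ‖harmonic Λ δ 2 v‖ + ‖harmonic Λ δ 3 v‖) / 2 :=
        norm_cornerObs_sub_le Λ δ v a b
    _ ≤ (ε / 2 * δ ^ ((1:ℝ) / 3) + ε / 2 * δ ^ ((1:ℝ) / 3) + ε / 2 * δ ^ ((1:ℝ) / 3)) / 2 := by
        gcongr
    _ ≤ ε * δ ^ ((1:ℝ) / 3) := by linarith

end Summit.CriticalPhenomena.CardyFormulaZ2.Cruxes.EdgeCoherence.FixedRadiusCut

end
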